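import Mathlib
import Summits.MatrixMultiplication.MatrixMultiplication.Theorems.SnSubsetDichotomyHyperoctahedralThresholdStubPatternTwin
import Summits.MatrixMultiplication.MatrixMultiplication.Theorems.SnSubsetDichotomyHyperoctahedralThresholdRotationIdentity

/-!
# The twins ℓ² reduction of the open core (crux `SnSubsetDichotomy.HyperoctahedralThreshold`,
# stmt-MatrixMultiplication-10883, line `refutation-local-symmetry`, open stub `stub_poorRigidCore`;
# siege seat k18, variation "twins ℓ² argument"; `--supports` helper, second file of two)

Vocabulary as in `…TwinDefects` (first file): involutions `μ c` of `Fin n`, right action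
`x · z := z.foldl (fun v c => μ c v) x`, cyclically reduced words of length `ℓ` written
`((univ : Finset (List.Vector (Fin 3) ℓ)).image toList).filter (IsChain (· ≠ ·) (z ++ z))`.  Four counts at length `ℓ`:

* `Pairs := #{(z, x, y) : x · z = x, y · z = y, x ≠ y}` — based TWIN PRE-PAIRS (the twin supply; lower bounds:
  `stub_twinSecondMoment` k22, `stub_twinSupplyCS` k26);
* `S₁ := #{(z, d, p, y) : 0 < d < ℓ, p · z = p, p · z.take d = p, y · z = y, y ≠ p}` — RETURNS × other fixed points
  (bounded by poorness × a dense-spot factor: `Σ_d Σ_p cw_d(p) cw_{ℓ−d}(p) · (N* − 1)`);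
* `RInc := #{(z, x, y) ∈ Pairs : x ∈ R}` — twin pre-pairs based in the forbidden set (`≤ |R| · max_r Σ_{z ∋ r}(N_z − 1)`);
* `Ξ := #{(z, y, e) : 0 < e < ℓ, y · z = y, (y · z.take e) · z = y · z.take e ≠ y}` — SLIDES, the (WM)/(AP) quantity of
  crux NOTES §§11–13 (generic value `≈ ℓ · Pairs / n`; no bound from poorness + rigidity is known — the open atom).

This file is the EXTRACTION step in incidence form (no import of `…TwinDefects`, so that it does not wait for that module's build):
`stub_twinsEll2Inc`: for `2 ≤ ℓ ≤ n^{1/4}`,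
      `2·#SELF-incidences + 2·#R-HIT-incidences + #CROSS-incidences < Pairs`  ⟹  the conclusion of `stub_poorRigidCore` verbatim
(a closed colour-walk of the rung graph with `ℓ` rungs, side-preserving steps, cyclically non-repeating colours, pairwise
equal-or-disjoint rungs, all points outside `R`), the three incidence sets being those of `…TwinDefects` (SELF: `x·z.take s = x·z.take t`,
`s < t`; CROSS: `x·z.take s = y·z.take t`; R-HIT: `x·z.take t ∈ R`).  Proof: a twin pre-pair is GOOD when both trajectories are simple,
avoid `R`, and never cross; bad pre-pairs are covered by the three incidence sets and their mirror images under `(x, y) ↦ (y, x)`; so a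
good pre-pair `(z; x, y)` exists, and `p t := x · z.take t`, `q t := y · z.take t`, `col t := z[t]` is clean data
(`cleanData_of_goodPair`, the construction of the landed `stub_patternTwin` with trivial patterns).  With `selfInc_le`, `crossInc_le`,
`rHit_le` (p114598) this gives the registered `stub_twinsEll2` (`ℓ·(2S₁ + 2RInc + Ξ) < Pairs ⇒ …`) and the conditional core
`stub_poorRigidCore ⇐` "some admissible `ℓ` satisfies the inequality" — a three-line composition left to the file that can import both.
Pure finite combinatorics; no hypothesis on `μ` at all.  No definitions are introduced.
-/

set_option linter.dupNamespace false

namespace Summit.MatrixMultiplication.MatrixMultiplication.Theorems.HyperoctahedralThreshold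

namespace TwinsEll2

open Finset Rotation

variable {n : ℕ}

/-! ### A good twin pre-pair is clean closed-walk data -/

/-- **Good pre-pair ⇒ clean data.**  If `x ≠ y` are fixed by the cyclically reduced `z` (`|z| ≥ 2`), both trajectories
are simple and avoid `R`, and they never cross (`x · z.take s ≠ y · z.take t`), then `p t := x · z.take t`,
`q t := y · z.take t`, `col t := z[t]` (`t : Fin (k+1)`, `k + 1 = |z|`) is clean closed-walk data in the format of the
core's conclusion: distinct rung ends, side-preserving steps (`GoodTwin.foldl_take_step`), cyclically distinct
consecutive colours (`GoodTwin.cyclic_ne`), pairwise equal-or-disjoint rungs (equal iff same index), points outside `R`.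
[construction of the landed `stub_patternTwin`, p107640] -/
theorem cleanData_of_goodPair (μ : Fin 3 → Equiv.Perm (Fin n)) (R : Finset (Fin n)) {z : List (Fin 3)}
    (hlen : 2 ≤ z.length) (hchain : List.IsChain (· ≠ ·) (z ++ z)) {x y : Fin n}
    (hx : z.foldl (fun v c => μ c v) x = x) (hy : z.foldl (fun v c => μ c v) y = y)
    (hsx : ∀ s < z.length, ∀ t < z.length,
      (z.take s).foldl (fun v c => μ c v) x = (z.take t).foldl (fun v c => μ c v) x → s = t)
    (hsy : ∀ s < z.length, ∀ t < z.length,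
      (z.take s).foldl (fun v c => μ c v) y = (z.take t).foldl (fun v c => μ c v) y → s = t)
    (hcross : ∀ s < z.length, ∀ t < z.length,
      (z.take s).foldl (fun v c => μ c v) x ≠ (z.take t).foldl (fun v c => μ c v) y)
    (hRx : ∀ t < z.length, (z.take t).foldl (fun v c => μ c v) x ∉ R)
    (hRy : ∀ t < z.length, (z.take t).foldl (fun v c => μ c v) y ∉ R) :
    ∃ (k : ℕ) (p q : Fin (k + 1) → Fin n) (col : Fin (k + 1) → Fin 3), (∀ i, p i ≠ q i) ∧
      (∀ i, (μ (col i) (p i) = p (i + 1) ∧ μ (col i) (q i) = q (i + 1)) ∨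
        (μ (col i) (p i) = q (i + 1) ∧ μ (col i) (q i) = p (i + 1))) ∧
      (∀ i, col i ≠ col (i + 1)) ∧
      (∀ i j, (p i = p j ∧ q i = q j) ∨ (p i = q j ∧ q i = p j) ∨
        (p i ≠ p j ∧ p i ≠ q j ∧ q i ≠ p j ∧ q i ≠ q j)) ∧
      (∀ i, p i ∉ R ∧ q i ∉ R) ∧ k + 1 = z.length := by
  obtain ⟨k, hk⟩ : ∃ k, k + 1 = z.length := ⟨z.length - 1, by omega⟩
  have hlt : ∀ i : Fin (k + 1), (i : ℕ) < z.length := fun i => i.isLt.trans_eq hk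
  have hval : ∀ i : Fin (k + 1), ((i + 1 : Fin (k + 1)) : ℕ) = ((i : ℕ) + 1) % z.length := fun i => by
    rw [PatternTwin.val_add_one]
    exact congrArg (fun N => ((i : ℕ) + 1) % N) hk
  refine ⟨k, fun i => (z.take i).foldl (fun v c => μ c v) x, fun i => (z.take i).foldl (fun v c => μ c v) y,
    fun i => z[(i : ℕ)]'(hlt i), ?_, ?_, ?_, ?_, ?_, hk⟩
  · intro i
    exact hcross i (hlt i) i (hlt i)
  · intro i
    refine Or.inl ⟨?_, ?_⟩
    · show μ (z[(i : ℕ)]'(hlt i)) ((z.take i).foldl (fun v c => μ c v) x) =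
        (z.take ((i + 1 : Fin (k + 1)) : ℕ)).foldl (fun v c => μ c v) x
      rw [hval i]
      exact GoodTwin.foldl_take_step μ z x hx i (hlt i)
    · show μ (z[(i : ℕ)]'(hlt i)) ((z.take i).foldl (fun v c => μ c v) y) =
        (z.take ((i + 1 : Fin (k + 1)) : ℕ)).foldl (fun v c => μ c v) y
      rw [hval i]
      exact GoodTwin.foldl_take_step μ z y hy i (hlt i)
  · intro i
    exact GoodTwin.cyclic_ne hchain i _ (hlt i) (hlt (i + 1)) (hval i)
  · intro i j
    by_cases hij : i = j
    · subst hij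
      exact Or.inl ⟨rfl, rfl⟩
    · have hij' : (i : ℕ) ≠ (j : ℕ) := fun h => hij (Fin.ext h)
      refine Or.inr (Or.inr ⟨fun h => hij' (hsx i (hlt i) j (hlt j) h), hcross i (hlt i) j (hlt j),
        fun h => hcross j (hlt j) i (hlt i) h.symm, fun h => hij' (hsy i (hlt i) j (hlt j) h)⟩)
  · intro i
    exact ⟨hRx i (hlt i), hRy i (hlt i)⟩

/-! ### The assembly: supply minus defects leaves a good pre-pair -/

/-- **The twins ℓ² count, incidence form.**  If at length `ℓ ≥ 2` the based twin pre-pairs outnumber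
`2·#SELF + 2·#R-HIT + #CROSS` (incidence sets of `…TwinDefects`), then some twin pre-pair `(z; x, y)` of length `ℓ` is good (simple,
`R`-free, non-crossing trajectories), hence clean closed-walk data with `ℓ` rungs avoiding `R` exist. [crux NOTES §11 (union bound)] -/
theorem cleanData_of_incCount (μ : Fin 3 → Equiv.Perm (Fin n)) (R : Finset (Fin n)) {ℓ : ℕ} (hℓ : 2 ≤ ℓ)
    (hcount : 2 * (((((univ : Finset (List.Vector (Fin 3) ℓ)).image (fun v => v.toList)).filter
        (fun z => List.IsChain (· ≠ ·) (z ++ z))) ×ˢ (univ : Finset (Fin n)) ×ˢ (univ : Finset (Fin n)) ×ˢ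
        range ℓ ×ˢ range ℓ).filter (fun t =>
          t.1.foldl (fun v c => μ c v) t.2.1 = t.2.1 ∧ t.1.foldl (fun v c => μ c v) t.2.2.1 = t.2.2.1 ∧
          t.2.1 ≠ t.2.2.1 ∧ t.2.2.2.1 < t.2.2.2.2 ∧
          (t.1.take t.2.2.2.1).foldl (fun v c => μ c v) t.2.1 =
            (t.1.take t.2.2.2.2).foldl (fun v c => μ c v) t.2.1)).card +
      2 * (((((univ : Finset (List.Vector (Fin 3) ℓ)).image (fun v => v.toList)).filter
        (fun z => List.IsChain (· ≠ ·) (z ++ z))) ×ˢ (univ : Finset (Fin n)) ×ˢ (univ : Finset (Fin n)) ×ˢ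
        range ℓ).filter (fun t =>
          t.1.foldl (fun v c => μ c v) t.2.1 = t.2.1 ∧ t.1.foldl (fun v c => μ c v) t.2.2.1 = t.2.2.1 ∧
          t.2.1 ≠ t.2.2.1 ∧ (t.1.take t.2.2.2).foldl (fun v c => μ c v) t.2.1 ∈ R)).card +
      (((((univ : Finset (List.Vector (Fin 3) ℓ)).image (fun v => v.toList)).filter
        (fun z => List.IsChain (· ≠ ·) (z ++ z))) ×ˢ (univ : Finset (Fin n)) ×ˢ (univ : Finset (Fin n)) ×ˢ
        range ℓ ×ˢ range ℓ).filter (fun t =>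
          t.1.foldl (fun v c => μ c v) t.2.1 = t.2.1 ∧ t.1.foldl (fun v c => μ c v) t.2.2.1 = t.2.2.1 ∧
          t.2.1 ≠ t.2.2.1 ∧
          (t.1.take t.2.2.2.1).foldl (fun v c => μ c v) t.2.1 =
            (t.1.take t.2.2.2.2).foldl (fun v c => μ c v) t.2.2.1)).card <
      (((((univ : Finset (List.Vector (Fin 3) ℓ)).image (fun v => v.toList)).filter
        (fun z => List.IsChain (· ≠ ·) (z ++ z))) ×ˢ (univ : Finset (Fin n)) ×ˢ (univ : Finset (Fin n))).filter
        (fun t => t.1.foldl (fun v c => μ c v) t.2.1 = t.2.1 ∧ t.1.foldl (fun v c => μ c v) t.2.2 = t.2.2 ∧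
          t.2.1 ≠ t.2.2)).card) :
    ∃ (k : ℕ) (p q : Fin (k + 1) → Fin n) (col : Fin (k + 1) → Fin 3), (∀ i, p i ≠ q i) ∧
      (∀ i, (μ (col i) (p i) = p (i + 1) ∧ μ (col i) (q i) = q (i + 1)) ∨
        (μ (col i) (p i) = q (i + 1) ∧ μ (col i) (q i) = p (i + 1))) ∧
      (∀ i, col i ≠ col (i + 1)) ∧
      (∀ i j, (p i = p j ∧ q i = q j) ∨ (p i = q j ∧ q i = p j) ∨
        (p i ≠ p j ∧ p i ≠ q j ∧ q i ≠ p j ∧ q i ≠ q j)) ∧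
      (∀ i, p i ∉ R ∧ q i ∉ R) ∧ k + 1 = ℓ := by
  classical
  -- names for the word set and the supply
  set W := ((univ : Finset (List.Vector (Fin 3) ℓ)).image (fun v => v.toList)).filter
    (fun z => List.IsChain (· ≠ ·) (z ++ z)) with hW
  set P := (W ×ˢ (univ : Finset (Fin n)) ×ˢ (univ : Finset (Fin n))).filter
    (fun t => t.1.foldl (fun v c => μ c v) t.2.1 = t.2.1 ∧ t.1.foldl (fun v c => μ c v) t.2.2 = t.2.2 ∧
      t.2.1 ≠ t.2.2) with hP
  -- the five kinds of bad pre-pairs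
  set BSx := P.filter (fun t => ∃ s < ℓ, ∃ s' < ℓ, s < s' ∧
    (t.1.take s).foldl (fun v c => μ c v) t.2.1 = (t.1.take s').foldl (fun v c => μ c v) t.2.1) with hBSx
  set BSy := P.filter (fun t => ∃ s < ℓ, ∃ s' < ℓ, s < s' ∧
    (t.1.take s).foldl (fun v c => μ c v) t.2.2 = (t.1.take s').foldl (fun v c => μ c v) t.2.2) with hBSy
  set BC := P.filter (fun t => ∃ s < ℓ, ∃ s' < ℓ,
    (t.1.take s).foldl (fun v c => μ c v) t.2.1 = (t.1.take s').foldl (fun v c => μ c v) t.2.2) with hBC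
  set BRx := P.filter (fun t => ∃ s < ℓ, (t.1.take s).foldl (fun v c => μ c v) t.2.1 ∈ R) with hBRx
  set BRy := P.filter (fun t => ∃ s < ℓ, (t.1.take s).foldl (fun v c => μ c v) t.2.2 ∈ R) with hBRy
  -- the incidence sets of the first file
  set SelfInc := (W ×ˢ (univ : Finset (Fin n)) ×ˢ (univ : Finset (Fin n)) ×ˢ range ℓ ×ˢ range ℓ).filter (fun t =>
    t.1.foldl (fun v c => μ c v) t.2.1 = t.2.1 ∧ t.1.foldl (fun v c => μ c v) t.2.2.1 = t.2.2.1 ∧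
    t.2.1 ≠ t.2.2.1 ∧ t.2.2.2.1 < t.2.2.2.2 ∧
    (t.1.take t.2.2.2.1).foldl (fun v c => μ c v) t.2.1 = (t.1.take t.2.2.2.2).foldl (fun v c => μ c v) t.2.1)
    with hSelfInc
  set CrossInc := (W ×ˢ (univ : Finset (Fin n)) ×ˢ (univ : Finset (Fin n)) ×ˢ range ℓ ×ˢ range ℓ).filter (fun t =>
    t.1.foldl (fun v c => μ c v) t.2.1 = t.2.1 ∧ t.1.foldl (fun v c => μ c v) t.2.2.1 = t.2.2.1 ∧
    t.2.1 ≠ t.2.2.1 ∧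
    (t.1.take t.2.2.2.1).foldl (fun v c => μ c v) t.2.1 = (t.1.take t.2.2.2.2).foldl (fun v c => μ c v) t.2.2.1)
    with hCrossInc
  set RHit := (W ×ˢ (univ : Finset (Fin n)) ×ˢ (univ : Finset (Fin n)) ×ˢ range ℓ).filter (fun t =>
    t.1.foldl (fun v c => μ c v) t.2.1 = t.2.1 ∧ t.1.foldl (fun v c => μ c v) t.2.2.1 = t.2.2.1 ∧
    t.2.1 ≠ t.2.2.1 ∧ (t.1.take t.2.2.2).foldl (fun v c => μ c v) t.2.1 ∈ R) with hRHit
  -- (1) bad pre-pairs are covered by incidences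
  have h1 : BSx.card ≤ SelfInc.card := by
    refine card_le_card_of_surjOn (fun a => (a.1, a.2.1, a.2.2.1)) ?_
    rintro ⟨z, x, y⟩ h
    rw [mem_coe, hBSx, mem_filter, hP, mem_filter] at h
    obtain ⟨⟨hmem, hx, hy, hxy⟩, s, hs, s', hs', hss', hcoin⟩ := h
    simp only [mem_product, mem_univ, and_true] at hmem
    refine ⟨(z, x, y, s, s'), ?_, rfl⟩
    rw [mem_coe, hSelfInc, mem_filter]
    simp only [mem_product, mem_univ, true_and, mem_range]
    exact ⟨⟨hmem, hs, hs'⟩, hx, hy, hxy, hss', hcoin⟩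
  have h2 : BC.card ≤ CrossInc.card := by
    refine card_le_card_of_surjOn (fun a => (a.1, a.2.1, a.2.2.1)) ?_
    rintro ⟨z, x, y⟩ h
    rw [mem_coe, hBC, mem_filter, hP, mem_filter] at h
    obtain ⟨⟨hmem, hx, hy, hxy⟩, s, hs, s', hs', hcoin⟩ := h
    simp only [mem_product, mem_univ, and_true] at hmem
    refine ⟨(z, x, y, s, s'), ?_, rfl⟩
    rw [mem_coe, hCrossInc, mem_filter]
    simp only [mem_product, mem_univ, true_and, mem_range]
    exact ⟨⟨hmem, hs, hs'⟩, hx, hy, hxy, hcoin⟩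
  have h3 : BRx.card ≤ RHit.card := by
    refine card_le_card_of_surjOn (fun a => (a.1, a.2.1, a.2.2.1)) ?_
    rintro ⟨z, x, y⟩ h
    rw [mem_coe, hBRx, mem_filter, hP, mem_filter] at h
    obtain ⟨⟨hmem, hx, hy, hxy⟩, s, hs, hR⟩ := h
    simp only [mem_product, mem_univ, and_true] at hmem
    refine ⟨(z, x, y, s), ?_, rfl⟩
    rw [mem_coe, hRHit, mem_filter]
    simp only [mem_product, mem_univ, true_and, mem_range]
    exact ⟨⟨hmem, hs⟩, hx, hy, hxy, hR⟩
  -- (2) the mirror images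
  have h4 : BSy.card ≤ BSx.card := by
    refine card_le_card_of_injOn (fun a => (a.1, a.2.2, a.2.1)) ?_ ?_
    · rintro ⟨z, x, y⟩ h
      rw [mem_coe, hBSy, mem_filter, hP, mem_filter] at h
      obtain ⟨⟨hmem, hx, hy, hxy⟩, hex⟩ := h
      simp only [mem_product, mem_univ, and_true] at hmem
      rw [mem_coe, hBSx, mem_filter, hP, mem_filter]
      simp only [mem_product, mem_univ, and_true]
      exact ⟨⟨hmem, hy, hx, fun h => hxy h.symm⟩, hex⟩
    · rintro ⟨z₁, x₁, y₁⟩ - ⟨z₂, x₂, y₂⟩ - h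
      simp only [Prod.mk.injEq] at h
      obtain ⟨rfl, rfl, rfl⟩ := h
      rfl
  have h5 : BRy.card ≤ BRx.card := by
    refine card_le_card_of_injOn (fun a => (a.1, a.2.2, a.2.1)) ?_ ?_
    · rintro ⟨z, x, y⟩ h
      rw [mem_coe, hBRy, mem_filter, hP, mem_filter] at h
      obtain ⟨⟨hmem, hx, hy, hxy⟩, hex⟩ := h
      simp only [mem_product, mem_univ, and_true] at hmem
      rw [mem_coe, hBRx, mem_filter, hP, mem_filter]
      simp only [mem_product, mem_univ, and_true]
      exact ⟨⟨hmem, hy, hx, fun h => hxy h.symm⟩, hex⟩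
    · rintro ⟨z₁, x₁, y₁⟩ - ⟨z₂, x₂, y₂⟩ - h
      simp only [Prod.mk.injEq] at h
      obtain ⟨rfl, rfl, rfl⟩ := h
      rfl
  -- (3) hence some pre-pair is in none of the five bad sets
  have hbad : (BSx ∪ BSy ∪ BC ∪ BRx ∪ BRy).card < P.card := by
    have hc : 2 * SelfInc.card + 2 * RHit.card + CrossInc.card < P.card := hcount
    calc (BSx ∪ BSy ∪ BC ∪ BRx ∪ BRy).card
        ≤ BSx.card + BSy.card + BC.card + BRx.card + BRy.card := by
          refine (card_union_le _ _).trans (Nat.add_le_add_right ?_ _)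
          refine (card_union_le _ _).trans (Nat.add_le_add_right ?_ _)
          refine (card_union_le _ _).trans (Nat.add_le_add_right ?_ _)
          exact card_union_le _ _
      _ ≤ SelfInc.card + SelfInc.card + CrossInc.card + RHit.card + RHit.card := by omega
      _ = 2 * SelfInc.card + 2 * RHit.card + CrossInc.card := by ring
      _ < P.card := hc
  obtain ⟨⟨z, x, y⟩, hzP, hgood⟩ := exists_mem_notMem_of_card_lt_card hbad
  simp only [mem_union, not_or] at hgood
  obtain ⟨⟨⟨⟨hnSx, hnSy⟩, hnC⟩, hnRx⟩, hnRy⟩ := hgood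
  rw [hP, mem_filter] at hzP
  obtain ⟨hmem, hx, hy, hxy⟩ := hzP
  simp only [mem_product, mem_univ, and_true] at hmem
  obtain ⟨hzl, hchain⟩ := mem_cycWords.1 hmem
  dsimp only at hx hy hxy
  -- (4) unpack goodness
  have memP : ((z, x, y) : List (Fin 3) × Fin n × Fin n) ∈ P := by
    rw [hP, mem_filter]
    simp only [mem_product, mem_univ, and_true]
    exact ⟨hmem, hx, hy, hxy⟩
  have hsx : ∀ s < z.length, ∀ t < z.length,
      (z.take s).foldl (fun v c => μ c v) x = (z.take t).foldl (fun v c => μ c v) x → s = t := by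
    intro s hs t ht h
    by_contra hst
    rcases Nat.lt_or_gt_of_ne hst with hlt | hlt
    · exact hnSx (by rw [hBSx, mem_filter]; exact ⟨memP, s, by omega, t, by omega, hlt, h⟩)
    · exact hnSx (by rw [hBSx, mem_filter]; exact ⟨memP, t, by omega, s, by omega, hlt, h.symm⟩)
  have hsy : ∀ s < z.length, ∀ t < z.length,
      (z.take s).foldl (fun v c => μ c v) y = (z.take t).foldl (fun v c => μ c v) y → s = t := by
    intro s hs t ht h
    by_contra hst
    rcases Nat.lt_or_gt_of_ne hst with hlt | hlt
    · exact hnSy (by rw [hBSy, mem_filter]; exact ⟨memP, s, by omega, t, by omega, hlt, h⟩)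
    · exact hnSy (by rw [hBSy, mem_filter]; exact ⟨memP, t, by omega, s, by omega, hlt, h.symm⟩)
  have hcross : ∀ s < z.length, ∀ t < z.length,
      (z.take s).foldl (fun v c => μ c v) x ≠ (z.take t).foldl (fun v c => μ c v) y := by
    intro s hs t ht h
    exact hnC (by rw [hBC, mem_filter]; exact ⟨memP, s, by omega, t, by omega, h⟩)
  have hRx : ∀ t < z.length, (z.take t).foldl (fun v c => μ c v) x ∉ R := by
    intro t ht h
    exact hnRx (by rw [hBRx, mem_filter]; exact ⟨memP, t, by omega, h⟩)
  have hRy : ∀ t < z.length, (z.take t).foldl (fun v c => μ c v) y ∉ R := by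
    intro t ht h
    exact hnRy (by rw [hBRy, mem_filter]; exact ⟨memP, t, by omega, h⟩)
  -- (5) the construction
  obtain ⟨k, p, q, col, h₁, h₂, h₃, h₄, h₅, hk⟩ :=
    cleanData_of_goodPair μ R (by omega) hchain hx hy hsx hsy hcross hRx hRy
  exact ⟨k, p, q, col, h₁, h₂, h₃, h₄, h₅, hk.trans hzl⟩

/-! ### Registered form -/

/-- **`stub_twinsEll2Inc` — the twins ℓ² extraction, incidence form** (registered `--supports` sub-goal of crux
stmt-MatrixMultiplication-10883): for a scale `2 ≤ ℓ ≤ n^{1/4}`, `2·#SELF + 2·#R-HIT + #CROSS < Pairs` yields the conclusion of the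
open core `stub_poorRigidCore` verbatim (with `k + 1 = ℓ` rungs).  Combined with `selfInc_le`, `crossInc_le`, `rHit_le` of
`…TwinDefects` (p114598) it gives `stub_twinsEll2`: `ℓ·(2S₁ + 2RInc + Ξ) < Pairs ⇒` the same conclusion. -/
theorem stub_twinsEll2Inc : ∀ (n ℓ : ℕ) (μ : Fin 3 → Equiv.Perm (Fin n)) (R : Finset (Fin n)), 2 ≤ ℓ → (ℓ : ℝ) ≤ (n : ℝ) ^ ((1 : ℝ) / 4) → 2 * (((((Finset.univ : Finset (List.Vector (Fin 3) ℓ)).image (fun v => v.toList)).filter (fun z => List.IsChain (· ≠ ·) (z ++ z))) ×ˢ (Finset.univ : Finset (Fin n)) ×ˢ (Finset.univ : Finset (Fin n)) ×ˢ Finset.range ℓ ×ˢ Finset.range ℓ).filter (fun t => t.1.foldl (fun v c => μ c v) t.2.1 = t.2.1 ∧ t.1.foldl (fun v c => μ c v) t.2.2.1 = t.2.2.1 ∧ t.2.1 ≠ t.2.2.1 ∧ t.2.2.2.1 < t.2.2.2.2 ∧ (t.1.take t.2.2.2.1).foldl (fun v c => μ c v) t.2.1 = (t.1.take t.2.2.2.2).foldl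 (fun v c => μ c v) t.2.1)).card + 2 * (((((Finset.univ : Finset (List.Vector (Fin 3) ℓ)).image (fun v => v.toList)).filter (fun z => List.IsChain (· ≠ ·) (z ++ z))) ×ˢ (Finset.univ : Finset (Fin n)) ×ˢ (Finset.univ : Finset (Fin n)) ×ˢ Finset.range ℓ).filter (fun t => t.1.foldl (fun v c => μ c v) t.2.1 = t.2.1 ∧ t.1.foldl (fun v c => μ c v) t.2.2.1 = t.2.2.1 ∧ t.2.1 ≠ t.2.2.1 ∧ (t.1.take t.2.2.2).foldl (fun v c => μ c v) t.2.1 ∈ R)).card + (((((Finset.univ : Finset (List.Vector (Fin 3) ℓ)).image (fun v => v.toList)).filter (fun z => List.IsChain (· ≠ ·) (z ++ z))) ×ˢ (Finset.univ : Finset (Fin n)) ×ˢ (Finset.univ : Finset (Fin n)) ×ˢ Finset.range ℓ ×ˢ Finset.range ℓ).filter (fun t => t.1.foldl (fun v c => μ c v) t.2.1 = t.2.1 ∧ t.1.foldl (fun v c => μ c v) t.2.2.1 = t.2.2.1 ∧ t.2.1 ≠ t.2.2.1 ∧ (t.1.take t.2.2.2.1).foldl (fun v c => μ c v) t.2.1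 = (t.1.take t.2.2.2.2).foldl (fun v c => μ c v) t.2.2.1)).card < (((((Finset.univ : Finset (List.Vector (Fin 3) ℓ)).image (fun v => v.toList)).filter (fun z => List.IsChain (· ≠ ·) (z ++ z))) ×ˢ (Finset.univ : Finset (Fin n)) ×ˢ (Finset.univ : Finset (Fin n))).filter (fun t => t.1.foldl (fun v c => μ c v) t.2.1 = t.2.1 ∧ t.1.foldl (fun v c => μ c v) t.2.2 = t.2.2 ∧ t.2.1 ≠ t.2.2)).card → ∃ (k : ℕ) (p q : Fin (k + 1) → Fin n) (col : Fin (k + 1) → Fin 3), (∀ i, p i ≠ q i) ∧ (∀ i, (μ (col i) (p i) = p (i + 1) ∧ μ (col i) (q i) = q (i + 1)) ∨ (μ (col i) (p i) = q (i + 1) ∧ μ (col i) (q i) = p (i + 1))) ∧ (∀ i, col i ≠ col (i + 1)) ∧ (∀ i j, (p i = p j ∧ q i = q j) ∨ (p i = q j ∧ q i = p j) ∨ (p i ≠ p j ∧ p i ≠ q j ∧ q i ≠ p j ∧ q i ≠ q j)) ∧ (∀ i, p i ∉ R ∧ q i ∉ R) ∧ ((k : ℝ) + 1) ≤ (n : ℝ)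 ^ ((1 : ℝ) / 4) := by
  intro n ℓ μ R hℓ hℓn hcount
  obtain ⟨k, p, q, col, h1, h2, h3, h4, h5, hk⟩ := cleanData_of_incCount μ R hℓ hcount
  refine ⟨k, p, q, col, h1, h2, h3, h4, h5, ?_⟩
  have : ((k : ℝ) + 1) = (ℓ : ℝ) := by exact_mod_cast hk
  rw [this]
  exact hℓn

end TwinsEll2

end Summit.MatrixMultiplication.MatrixMultiplication.Theorems.HyperoctahedralThreshold
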